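import Summits.Ventures.PercRepro.SixFourResidueClauses
import Summits.Ventures.PercRepro.SixFourResidueSmallClause

/-!
# PercRepro — C-025 at `(6,4)`: the small clause is discharged; the residue in TWO clauses (p3, gen 10)

p2's `J_four_nonneg_of_card_le_nine` (`SixFourResidueSmallClause.lean`: `0 ≤ J₄(G)` for every rank-`4` set
`G ⊆ E` of a simple matroid with at most `9` points, mine-2's §21.18.5 trichotomy) is exactly `SmallClause` of
`SixFourResidueClauses.lean`.  Hence **`smallClause_holds`**, and `SixFourResidue` — the last hypothesis of C-025 at
`(6,4)` — reduces to the type-`3` clause and the big-plane clause: **`sixFourResidue_of_two_clauses`**,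
**`rls_six_four_of_two_clauses`**.
-/

namespace PercRepro.SixFour

open Finset ThmH PerFlat ThmN

/-- **The small clause holds** (p2's `J_four_nonneg_of_card_le_nine`). -/
theorem smallClause_holds : SmallClause := by
  intro β _ M _ G hs hG hr hg
  exact J_four_nonneg_of_card_le_nine hs hG hr hg

/-- **`SixFourResidue` from the type-`3` clause and the big-plane clause.** -/
theorem sixFourResidue_of_two_clauses (h3 : TypeThreeClause) (h4b : BigPlaneClause) : SixFourResidue :=
  sixFourResidue_of_clauses h3 smallClause_holds h4b

/-- **C-025 at `(6, 4)` on every finite matroid from the type-`3` clause and the big-plane clause**: `RLS M 6 4`. -/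
theorem rls_six_four_of_two_clauses {α : Type} (h3 : TypeThreeClause) (h4b : BigPlaneClause) (M : Matroid α)
    [M.Finite] : RLS M 6 4 :=
  rls_six_four_of_residue (sixFourResidue_of_two_clauses h3 h4b) M

end PercRepro.SixFour
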